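import Summits.BirchSwinnertonDyer.BirchSwinnertonDyer.Theorems.ClassRecordThreeLeafOfClassicalFrameValue
import Summits.BirchSwinnertonDyer.BirchSwinnertonDyer.Theorems.KolyvaginRoadThreeHalvesTamAtThree
import Summits.BirchSwinnertonDyer.Rank1Residual.X11b.Three.ClassRecordKoly
import HarnessLib

/-!
# Route `KolyvaginRoadThree` (rung K2@3, third route) — PROOF-BDP's COROLLARY C.6 in the kernel: modulo THEOREM C
# typed, the leaf `X11b.MultiplicativeRankOneAtThree` follows from the route's items WITHOUT `HsiehDescentAtThree`

Cell `bsd-stepL` (run/shared/lean/pub/bsd-stepL/), seat `bsd-stepL-thmc-p1` (prover g0, D-0074 hands, 2026-08-26),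
`--supports stmt-BirchSwinnertonDyer-19155` (helper). Twin of `Theorems/ClassRecordThreeLeafOfClassicalFrameValue.lean`
for the Kolyvagin road: the koly record `Three.forall_bsdp_of_kolyRecord` (X11b/Three/ClassRecordKoly.lean, koly K-1)
routes H1 on the Tamagawa cells and on road (d) through Hsieh 2014 Thm. 1 (`hH`) + the named descent residual
`Three.HsiehDescentAt₃` (`hDb` ∕ `hDd`); here those three binders are REPLACED by THEOREM C typed (`hC`, the binder
`h12` of `Three.bdpValueAt₃_of_frameValue` ∀ W, inline), which gives H1 descent-free
(`bdpExistsAt₃_of_classicalFrameValue`, Cor. C.6). The proof is the koly record's, road by road, with that one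
substitution; every road lemma is the tree's (`Three.stepLAt_of_halves₃_of_classX11b`,
`Three.bsdp_three_of_surj_of_stepLAt_of_shapes`, `Three.bsdp_of_ram_of_nonsplit_of_regulatorNonvanishing`, the corner's
`missingPPartAt_of_corner_*_of_inputs`, `hEP` := `GaloisImage.EP.localEulerPoincareCharacteristic_adicCompletion`).

* `forall_bsdp_of_kolyRecord_of_classicalFrameValue` — the koly record with `hH`, `hDb`, `hDd` replaced by `hC`.
* `kolyvaginRoadThree_closes_of_classicalFrameValue_without_hsiehDescent` — the route's `Assembly` with its fourth
  hypothesis `HsiehDescentAtThree` (shared item 19108) DELETED, modulo THEOREM C typed: `ZhangSharpFrameAtThree →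
  SchneiderTamAtThree → HalvesTamAtThree → EulerHalvesAtThree → ShimuraDisplaysAtThree → CornerAtThree →
  PublishedInputsKolyThree → X11b.MultiplicativeRankOneAtThree` (A1 by `Koly.bsdp_three_onA1_of_kolyvaginFrames`, as
  the route's `closes`).

READING (planner ∕ director decide; nothing booked): as for ClassRecordThree — THEOREM C typed, already the price of the
H2 half of `HalvesTamAtThree` (item 19155), also pays for H1@3, so modulo that one refereed memo theorem the shared
crux `HsiehDescentAtThree` (19108 → 19238 ∕ 19281 ∕ 19240) is not needed for this route's leaf either.

HONEST FRAMING: implications only; THEOREM C is a refereed MEMO theorem, not kernel, not a Literature fact; the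
Kolyvagin crux, Schneider on the Tamagawa cells, H3, the (T2′)₃ ∕ Shimura ∕ corner inputs and the published facts
stay hypotheses. Nothing is discharged; no census count moves (T7); O2 stays OPEN; BSD is not proved for any class.

References: [Castella2018] arXiv:1704.06608 Thm. 2.3, Thm. 3.1–3.3, §5; [CastellaHsieh2018] Prop. 3.6; [KrizLi2019] §2;
[McCallumLMS1991] Cor. 5.6; [MatarNekovar2019] Thm. 0.3; cell memo PROOF-BDP §20.5 (C.6); tree
X11b/Three/ClassRecordKoly.lean (koly K-1), Theorems/ClassRecordThreeKolyGlue.lean (p410690).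
-/

noncomputable section

open scoped Classical Topology

open Filter WeierstrassCurve NumberField IsDedekindDomain Field PowerSeries
  Rat.HeightOneSpectrum
  Literature.NumberTheory.DiophantineGeometry
  Literature.NumberTheory.EllipticCurves Literature.NumberTheory.EllipticCurves.ModularForms
  Literature.NumberTheory.EllipticCurves.GreenbergSelmer
  Literature.NumberTheory.EllipticCurves.Rank1Residual
  Literature.NumberTheory.EllipticCurves.Rank1Residual.Typed
  Literature.NumberTheory.EllipticCurves.Wuthrich2014
  Literature.NumberTheory.EllipticCurves.BalakrishnanEtAl2019
  Literature.NumberTheory.EllipticCurves.Skinner2016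
  Literature.NumberTheory.EllipticCurves.SteinWuthrich2013
  Literature.NumberTheory.EllipticCurves.Disegni2020
  Literature.NumberTheory.EllipticCurves.BarriosEtAl2025
  Literature.NumberTheory.QuadraticFields.Quadratic
  Literature.NumberTheory.Automorphic
  Literature.NumberTheory.GaloisRepresentations Literature.NumberTheory.GaloisCohomology
  Summit.BirchSwinnertonDyer.Rank1Residual Summit.BirchSwinnertonDyer.Rank1Residual.X11b
  Summit.BirchSwinnertonDyer.Rank1Residual.X11b.AcSelmer
  Summit.BirchSwinnertonDyer.Rank1Residual.X11b.LocBridge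
  Summit.BirchSwinnertonDyer.Rank1Residual.X11b.CongruenceLimit
  Summit.BirchSwinnertonDyer.Rank1Residual.X11b.Halves
  Summit.BirchSwinnertonDyer.Rank1Residual.X11b.Three
  Summit.BirchSwinnertonDyer.BirchSwinnertonDyer.Theses

namespace Summit.BirchSwinnertonDyer.BirchSwinnertonDyer.Theorems

section TheoremC

/- THEOREM C of the cell at `p = 3`, TYPED = the binder `h12` of `Three.bdpValueAt₃_of_frameValue` verbatim, ∀ W
(INLINE hypothesis, no definition). Memo-proved and refereed; NOT a kernel theorem. -/
variable
  (hC : ∀ (W : WeierstrassCurve ℚ) [W.IsElliptic] [W.IsGloballyMinimal],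
    ∀ (N : ℕ) [NeZero N] (K : Type) [Field K] [NumberField K] (Dt : ModularParametrizationData W N)
    (H : HeegnerDatum N (NumberField.discr K)) (ι : K →+* ℂ) (P : (W.baseChange K).toAffine.Point),
    ClassX11b W 3 → Surj W 3 → W.conductorNorm ℤ = N → IsImaginaryQuadratic K →
    Odd (NumberField.discr K) → SatisfiesHeegnerHypothesis N K →
    (W.quadraticTwist (NumberField.discr K : ℚ)).entireLFunction 1 ≠ 0 →
    WeierstrassCurve.Affine.Point.map ι.toRatAlgHom P = heegnerPointComplex Dt H →
    ¬ (3 : ℤ) ∣ Dt.c → ¬ IsOfFinAddOrder P →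
    ∀ (κ : ZpExtension K 3), κ.IsAnticyclotomic →
      ∀ (γ : Field.absoluteGaloisGroup K) [Fact (κ.IsTopGenerator γ)]
        (𝔭 : HeightOneSpectrum (𝓞 K)) (h𝔭 : ((3 : ℕ) : 𝓞 K) ∈ 𝔭.asIdeal)
        (he : 𝔭.asIdeal.ramificationIdx (𝓞 ℚ) = 1) (hf : 𝔭.asIdeal.inertiaDeg (𝓞 ℚ) = 1),
        ∀ (f : CuspForm (CongruenceSubgroup.Gamma0 N) 2), IsNewformOf W f →
          ∀ (ι' : PadicAlgCl 3 ≃+* ℂ), InducesPrime ι' 𝔭 →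
            ∃ (ΩK : ℂ) (Ωp : (unrIntegers 3)ˣ) (L : UnrSeries 3),
              ΩK ≠ 0 ∧ IsBDPLFunction ι' 𝔭 κ γ f ΩK ((Ωp : unrIntegers 3) : ℂ_[3]) L ∧
              ∃ u : (unrIntegers 3)ˣ, L.HasValueAt 0 (((u : unrIntegers 3) : ℂ_[3]) *
                (algebraMap ℚ_[3] ℂ_[3] (((1 : ℚ_[3]) - ((W.LFunction 3 : ℤ) : ℚ_[3]) * (3 : ℚ_[3])⁻¹) *
                  logOmega W 3 (embAt K 3 𝔭 h𝔭 he hf) P)) ^ 2))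

include hC in
/-- **The KOLY RECORD with H1 by THEOREM C (Cor. C.6) instead of Hsieh 2014 + the descent residual.**
`Three.forall_bsdp_of_kolyRecord` with the binders `hH` (Hsieh 2014 Thm. 1), `hDb`, `hDd` (`Three.HsiehDescentAt₃` on
(ram) ∧ split resp. ¬(ram) ∧ surj) REPLACED by THEOREM C typed `hC`; every other binder (19 published facts, the
Kolyvagin road `hA1` on A1, Schneider `hReg` and the halves `hHb` on the Tamagawa cells, `hSh hUα hUγ`, road (d)
`hHd hU₀`, the corner `hCL hCT hCU`) byte-identical, and the proof is the koly record's case split with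
`bdpExistsAt₃_of_classicalFrameValue hC W` in place of `bdpExistsAt₃_of_hsieh2014_of_descent …`. CONDITIONAL on
every binder. [cite: Castella2018, §5 (arXiv:1704.06608 p. 12) (assembly shape at p ∣ N; inputs typed, not asserted)]
[cite: McCallumLMS1991, §5 Cor. 5.6 (p. 310)] [cite: MatarNekovar2019, Thm. 0.3 (p. 456)] -/
theorem forall_bsdp_of_kolyRecord_of_classicalFrameValue
    (hGZ : ∀ (N : ℕ) [NeZero N] (W : WeierstrassCurve ℚ) (K : Type) [Field K] [NumberField K],
      gross_zagier N W K)
    (hKo : ∀ (N : ℕ) [NeZero N] (W : WeierstrassCurve ℚ) (K : Type) [Field K] [NumberField K],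
      kolyvagin N W K)
    (hB : ∀ (N : ℕ) [NeZero N] (W : WeierstrassCurve ℚ) (K : Type) [Field K] [NumberField K],
      Kolyvagin1990_padicValNat_card_sha_le N W K)
    (hSk : Skinner2016.thmC_padicValRat_bsd_rank_zero) (hWu : sha_dvd_analyticSha)
    (hGZK : rank_eq_analyticRank_of_analyticRank_le_one) (hmod : hasEntireLFunction_rat)
    (hnf : exists_isNewformOf) (hHL : HoffsteinLuo1997_exists_twist_L_one_ne_zero)
    (hMaz : mazur_not_dvd_maninConstant_of_odd)
    (hPT : ∀ (K : Type) [Field K] [NumberField K], poitouTate_sum_localTatePairing_eq_zero K)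
    (hFH : friedbergHoffstein_exists_twist_ne_zero_inertAt)
    (hBR : localTamagawaNumber_quadraticTwist_two_mem_of_goodReduction)
    (hSkA : thmA_charIdeal_multiplicative) (hJn : thm61_nonsplitMultiplicative)
    (hHn : exists_isMultCanonical) (hD : thm1_padicBSD_rankOne_multiplicative)
    (hpar : nonempty_modularParametrizationData)
    (hMN : ∀ (N : ℕ) [NeZero N] (W : WeierstrassCurve ℚ) (K : Type) [Field K] [NumberField K],
      MatarNekovar2019.thm03_padicValNat_card_sha_le_of_irreducible N W K)
    -- THE KOLYVAGIN ROAD on A1 = (ram) ∧ 3 ∤ ∏c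
    (hA1 : ∀ (W : WeierstrassCurve ℚ) [W.IsElliptic] [W.IsGloballyMinimal],
      ClassX11b W 3 → Ram W 3 → ¬ 3 ∣ W.tamagawaProduct → BSDp W 3)
    -- ROAD (a) on the Tamagawa cells
    (hReg : ∀ (W : WeierstrassCurve ℚ) [W.IsElliptic] [W.IsGloballyMinimal],
      ClassX11b W 3 → Ram W 3 → ¬ W.HasSplitMultiplicativeReductionAtPrime 3 → 3 ∣ W.tamagawaProduct →
        ClassClosure.RegulatorNonvanishingAt W 3)
    -- ROAD (b) on the Tamagawa cells: H2 ∧ H3 (H1 by THEOREM C)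
    (hHb : ∀ (W : WeierstrassCurve ℚ) [W.IsElliptic] [W.IsGloballyMinimal],
      ClassX11b W 3 → Ram W 3 → W.HasSplitMultiplicativeReductionAtPrime 3 → 3 ∣ W.tamagawaProduct →
        BDPValueAt₃ W ∧ IMCDivAt₃ W)
    (hSh : ∀ (W : WeierstrassCurve ℚ) [W.IsElliptic] [W.IsGloballyMinimal],
      ClassX11b W 3 → Ram W 3 → W.HasSplitMultiplicativeReductionAtPrime 3 → ¬ ShapeAlpha W →
        ¬ ShapeGamma W → 3 ∣ W.tamagawaProduct → P2ShimuraDisplaysAt W 3)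
    (hUα : ∀ (W : WeierstrassCurve ℚ) [W.IsElliptic] [W.IsGloballyMinimal],
      ClassX11b W 3 → Ram W 3 → ShapeAlpha W → Typed.MissingUpperBoundAt W 3)
    (hUγ : ∀ (W : WeierstrassCurve ℚ) [W.IsElliptic] [W.IsGloballyMinimal],
      ClassX11b W 3 → Ram W 3 → W.HasSplitMultiplicativeReductionAtPrime 3 → ¬ ShapeAlpha W →
        ShapeGamma W → Typed.MissingUpperBoundAt W 3)
    -- ROAD (d) `¬Ram ∧ Surj`: H2 ∧ H3 (H1 by THEOREM C) + the upper half
    (hHd : ∀ (W : WeierstrassCurve ℚ) [W.IsElliptic] [W.IsGloballyMinimal],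
      ClassX11b W 3 → ¬ Ram W 3 → Surj W 3 → BDPValueAt₃ W ∧ IMCDivAt₃ W)
    (hU₀ : ∀ (W : WeierstrassCurve ℚ) [W.IsElliptic] [W.IsGloballyMinimal],
      ClassX11b W 3 → Surj W 3 → ¬ Ram W 3 → Typed.MissingUpperBoundAt W 3)
    -- THE (T4″)@3 CORNER
    (hCL : ∀ (W : WeierstrassCurve ℚ) [W.IsElliptic] [W.IsGloballyMinimal], CornerStepLAt W)
    (hCT : ∀ (W : WeierstrassCurve ℚ) [W.IsElliptic] [W.IsGloballyMinimal], CornerTwistAt W)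
    (hCU : ∀ (W : WeierstrassCurve ℚ) [W.IsElliptic] [W.IsGloballyMinimal], CornerUpperAt W)
    (W : WeierstrassCurve ℚ) [W.IsElliptic] [W.IsGloballyMinimal] (hX : ClassX11b W 3) :
    BSDp W 3 := by
  have hEP : ∀ (K : Type) [Field K] [NumberField K] (v : HeightOneSpectrum (𝓞 K)),
      localEulerPoincareCharacteristic (v.adicCompletion K) :=
    GaloisImage.EP.localEulerPoincareCharacteristic_adicCompletion
  by_cases hram : Ram W 3
  · by_cases htam : 3 ∣ W.tamagawaProduct
    · by_cases hs : W.HasSplitMultiplicativeReductionAtPrime 3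
      · -- road (b) on the Tamagawa cells: StepLAt W from THEOREM C's H1 + H2 ∧ H3 at W
        have hL : StepLAt W :=
          stepLAt_of_halves₃_of_classX11b hnf hKo hPT hEP hX (bdpExistsAt₃_of_classicalFrameValue hC W)
            (hHb W hX hram hs htam).1 (hHb W hX hram hs htam).2
        exact bsdp_three_of_surj_of_stepLAt_of_shapes hGZ hKo hB hSk hWu hGZK hmod hnf hHL hMaz hFH hBR
          hPT hEP W hX (surj_of_irr_of_ram W 3 hX.2.2.2 hram) hL
          (fun hram hα hγ ht ↦ hSh W hX hram hs hα hγ ht) (fun hram hα ↦ hUα W hX hram hα)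
          (fun hram hα hγ ↦ hUγ W hX hram hs hα hγ) (fun h ↦ absurd hram h)
      · -- road (a) on the Tamagawa cells
        exact bsdp_of_ram_of_nonsplit_of_regulatorNonvanishing hSkA hJn hHn hD hGZK hpar W 3 hX hram hs
          (hReg W hX hram hs htam)
    · -- A1: the Kolyvagin road decides
      exact hA1 W hX hram htam
  · by_cases hsurj : Surj W 3
    · -- road (d): StepLAt W from THEOREM C's H1 + H2 ∧ H3 at W
      have hL₀ : StepLAt W :=
        stepLAt_of_halves₃_of_classX11b hnf hKo hPT hEP hX (bdpExistsAt₃_of_classicalFrameValue hC W)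
          (hHd W hX hram hsurj).1 (hHd W hX hram hsurj).2
      exact bsdp_three_of_surj_of_stepLAt_of_shapes hGZ hKo hB hSk hWu hGZK hmod hnf hHL hMaz hFH hBR
        hPT hEP W hX hsurj hL₀ (fun h _ _ _ ↦ absurd h hram) (fun h _ ↦ absurd h hram)
        (fun h _ _ ↦ absurd h hram) (fun _ ↦ hU₀ W hX hsurj hram)
    · -- the corner, as the koly record
      have hU : ∀ (W : WeierstrassCurve ℚ) [W.IsElliptic] [W.IsGloballyMinimal],
          ClassX11b W 3 → ¬ Surj W 3 → 3 ∣ W.tamagawaProduct → Typed.MissingUpperBoundAt W 3 :=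
        fun W _ _ hX hns ht ↦
          missingUpperBoundAt_of_cornerUpperAt hGZ hKo hGZK hmod hnf hHL hMaz W hX hns ht (hCU W) (hCT W)
      obtain ⟨hdvd, hnr⟩ := ClassX11b.dvd_and_not_ram_of_not_surj W 3 hX hsurj
      refine Typed.bsdp_of_missingPPartAt W 3 hGZK (by rw [hX.1]) ?_
      by_cases hs : W.HasSplitMultiplicativeReductionAtPrime 3
      · exact missingPPartAt_of_corner_split_of_inputs hGZ hKo hGZK hmod hnf hHL hMaz hPT hEP hMN
          (fun W _ _ ↦ hCL W) (fun W _ _ ↦ hCT W) hU W hX hsurj hdvd hnr hs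
      · exact missingPPartAt_of_corner_nonsplit_of_inputs hGZ hKo hGZK hmod hnf hHL hMaz hPT hEP hMN
          (fun W _ _ ↦ hCL W) (fun W _ _ ↦ hCT W) hU W hX hsurj hdvd hnr hs

include hC in
/-- **Route `KolyvaginRoadThree`'s Assembly with `HsiehDescentAtThree` DELETED, modulo THEOREM C typed**:
`ZhangSharpFrameAtThree → SchneiderTamAtThree → HalvesTamAtThree → EulerHalvesAtThree → ShimuraDisplaysAtThree →
CornerAtThree → PublishedInputsKolyThree → X11b.MultiplicativeRankOneAtThree` (compare the route's `Assembly`, whose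
fourth hypothesis is the shared item `HsiehDescentAtThree`). A1 by `Koly.bsdp_three_onA1_of_kolyvaginFrames` exactly as
the route's `closes`; the support's Hsieh 2014 conjunct is unused. PROOF-BDP §20.5 Cor. C.6 in kernel form for the
third route; the planner decides. CONDITIONAL; closes nothing by itself.
[cite: Castella2018, §5 (arXiv:1704.06608 p. 12) (assembly shape at p ∣ N)] [cite: McCallumLMS1991, §5 Cor. 5.6 (p. 310)] -/
theorem kolyvaginRoadThree_closes_of_classicalFrameValue_without_hsiehDescent
    (h₁ : KolyvaginRoadThree.ZhangSharpFrameAtThree) (h₂ : KolyvaginRoadThree.SchneiderTamAtThree)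
    (h₃ : KolyvaginRoadThree.HalvesTamAtThree) (h₅ : KolyvaginRoadThree.EulerHalvesAtThree)
    (h₆ : KolyvaginRoadThree.ShimuraDisplaysAtThree) (h₇ : KolyvaginRoadThree.CornerAtThree)
    (h₈ : KolyvaginRoadThree.PublishedInputsKolyThree) :
    Summit.BirchSwinnertonDyer.Rank1Residual.X11b.MultiplicativeRankOneAtThree := by
  obtain ⟨⟨hGZ, hKo, hB, hSk, hWu, hGZK, hmod, hnf, hHL, hMaz, hPT, hFH, hBR, hSkA, hJn, hHn, hD, hpar, hMN, -⟩,
    hMc, hrec, hKD⟩ := h₈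
  rw [multiplicativeRankOneAtThree_iff]
  intro W _ _ hX
  exact forall_bsdp_of_kolyRecord_of_classicalFrameValue hC hGZ hKo hB hSk hWu hGZK hmod hnf hHL hMaz hPT hFH
    hBR hSkA hJn hHn hD hpar hMN
    (fun W _ _ hX hram htam ↦
      Koly.bsdp_three_onA1_of_kolyvaginFrames hGZ hKo hB hSk hGZK hmod hnf hHL hMaz hrec hMc hKD h₁ W hX hram htam)
    h₂ (fun W _ _ hX ↦ (h₃ W hX).1) h₆ (fun W _ _ hX ↦ (h₅ W hX).1) (fun W _ _ hX ↦ (h₅ W hX).2.1)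
    (fun W _ _ hX ↦ (h₃ W hX).2) (fun W _ _ hX ↦ (h₅ W hX).2.2)
    (fun W _ _ ↦ (h₇ W).1) (fun W _ _ ↦ (h₇ W).2.1) (fun W _ _ ↦ (h₇ W).2.2) W hX

end TheoremC

end Summit.BirchSwinnertonDyer.BirchSwinnertonDyer.Theorems

end
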